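import Summits.QuantumFields.YangMills.Theorems.BalabanUVNodesN15PerCubeGreenLandauLetterCloseCutBox
import Summits.QuantumFields.YangMills.Theorems.BalabanUVNodesN15PerCubeGreenRows
import HarnessLib

/-!
# N15 = NE2, road (c) — PROGRAMME (PC), (PC-D) «the per-cube LANDAU LETTER», IX: BEHIND THE KNIT's INPUT CUT — `(landauCov(U^{w_k}) − landauCov(𝟙)) ∘ M_{χ_k} ≤ B·(Σ(r_V) + 2e^{−δL^m})·e^{−δd}`
# on the coloured bond carrier: the per-cube Landau perturbation in 52's `hNVcut`∕`hfarN` currency (input cut `χ_k` = indicator of `c(2w,k)+[0,6w+1)^{d+1}`), from n15-c∕313's weighted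
# letter by the Lipschitz property of `d_Z` (dag-n15-c g29, n15-c∕314)

Cell `pub-ymgap`, seat `pub-ymgap-dag-n15-c` (generation g29; R134 (a), s1; HUMAN RULING D-0062).  `bears_on: R4∕N15 · K3⁸ SpineGivenEndpointR13SepCoPHV (stmt-QuantumFields-27366)`;
filed `--kind proof --supports stmt-QuantumFields-27366 --as helper` — COUNT-NEUTRAL.  Two theorems (one abstract real inequality, one assembly), 0 `def`, 0 `sorry`.  Imports BY NAME
n15-c∕313 `exists_landauCov_gaugeTr_sub_flat_cutBox` and n15-c∕261 `hasMaj_comp_mulOp_cut` (a source cut inserts the indicator of its block set into a majorant); FILE 36's `chiCube`,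
`abs_chiCube_le_one`.  Nothing in the tree is modified.

WHY ((PC-D), the knit's currency).  52's knit (n15-c∕202∕203 for the covariant summand) reads each per-cube perturbation `N_V k` through the rows `N_V k ∘ M_{χ_k}` (`hNVcut`) and
`(1 − M_{ψ_k}) ∘ N_V k ∘ M_{χ_k}` (`hfarN`) with SMALL letters.  n15-c∕313 gives the Landau part of `N_V k` the weighted row `B·(Σ(r_V) + e^{−δd_Z(z)} + e^{−δd_Z(z′)})·e^{−δd}` with
`d_Z ≥ w = L^m` on every block of `supp χ_k` and `d_Z` Lipschitz; behind the input cut both weights are small: `e^{−δd_Z(z′)} ≤ e^{−δw}` and, by `d_Z(z′) ≤ |z′−z| + d_Z(z)`,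
`e^{−δd_Z(z)}·e^{−δ|z−z′|} ≤ e^{−δw∕2}·e^{−(δ∕2)|z−z′|}` (§1).  Hence §2: the input-cut row with the letter `B·(Σ(r_V) + 2e^{−(δ∕2)L^m})` — small with `r_V → 0`, `L^m → ∞` — at the rate `δ∕2`;
the output cut `M_{ψ_k}` or its complement (entries `≤ 1`) is the consumer's one-liner.

WHAT.  §1 `farWeights_cut_le` (the real inequality).  §2 ★★★★ `hasMaj_landauCov_gaugeTr_sub_flat_cut`: under n15-c∕313's hypotheses, for every cube `k`:
`(mulVecLin (landauCov (cvT e U^{w_k}) a_K) − mulVecLin (landauCov 𝟙 a_K)) ∘ M_{χ_k} ≤ B·(r_V(1+|J⊕J|) + a_K|ι|(|ι|σ²+2σ) + σ + (L^m)⁻¹ + 2e^{−δL^m})·e^{−δ|z−z′|_T}`.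

HONEST FRAMING ∕ LIMITS.  MODEL carriers (n15-c∕260's cover; site transporters `cvT`; the knit's bond-point convention `cvT₀`∕`cvNVr` of n15-c∕201 is the consumer's dictionary step);
composition of LANDED theorems; [B9] (3.49) p.399, Thm 3.4 p.400, (3.59)–(3.60) p.402, Cor. 3.8 p.410 cited for SHAPES ∕ MECHANISM, NOT the printed statements.  NE2⁺ NOT PRINTED, NOT
proved; N15 of record untouched (DISCHARGED AS CONSUMED, p687738); K3⁸ OPEN; counts of record UNMOVED; one finite 𝕋⁴ at fixed ε per index — NOT infinite volume, NOT OS on ℝ⁴, NOT a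
mass gap, NOT Clay.  Restate-immune (no Theses import).
-/

noncomputable section

open scoped BigOperators Matrix Matrix.Norms.L2Operator

namespace Summit.QuantumFields.YangMills.BalabanUVNodes.N15.Gluing

open Real
open Literature.MathematicalPhysics.QuantumFieldTheory.Balaban1983to89
open Literature.MathematicalPhysics.QuantumFieldTheory.Balaban1983to89.B5Prop11Plancherel (Tor fine unitVec)
open Literature.MathematicalPhysics.QuantumFieldTheory.Balaban1983to89.B5Block118 (up bpt)
open Literature.MathematicalPhysics.QuantumFieldTheory.Balaban1983to89.B11SectG (BlockNorm HasMaj RowSum)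
open Literature.MathematicalPhysics.QuantumFieldTheory.Balaban1983to89.B6RandomWalk (Triangle254)
open Literature.MathematicalPhysics.QuantumFieldTheory.Balaban1983to89.B6UnitTorusCarrier (unitTorusGeo triangle254_unitTorusGeo rowSum_unitTorusGeo unitTorusGeo_dist_nonneg unitTorusGeo_dist_self)
open Literature.MathematicalPhysics.QuantumFieldTheory.Balaban1983to89.B9Eq335RegularityClasses (Reg335Cube)
open Literature.MathematicalPhysics.QuantumFieldTheory.Balaban1983to89.B9Eq336RegularityClassesOrbit (reg335Cube_gaugeTr)
open Literature.MathematicalPhysics.QuantumFieldTheory.Balaban1983to89.B9Eq3117Current (gaugeTr gaugeTr_one)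
open Literature.MathematicalPhysics.QuantumFieldTheory.Balaban1983to89.B9Eq39Adjoint (covD fluct)
open Summit.QuantumFields.YangMills.BalabanUVNodes.N15.CovLandau (cSop cSop_gauge landauCov landauCov_gauge bdiag bdiag_transpose bdiag_mul_bdiag bdiag_one bdiag_orth bdiag_orth' isUnit_cSop mulVecLin_sub')
open Summit.QuantumFields.YangMills.BalabanUVNodes.N15.BackgroundModel (kappa_ofBlocks)
open Literature.MathematicalPhysics.QuantumFieldTheory.King1986 (aK aK_pos aK_le aK_ge)
open Literature.MathematicalPhysics.QuantumFieldTheory.King1986.Torus (blockOf)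
open Literature.Barriers.QuantumFields (traceForm)
open Summit.QuantumFields.YangMills.BalabanUVNodes.N15.MatrixSpecies (mmulOp coordMat basisConst liftBlk mmulOp_comp_mmulOp)
open Summit.QuantumFields.YangMills.BalabanUVNodes.N15.TwoGrid (cubeBlocks chiCube abs_chiCube_le_one)
open Literature.MathematicalPhysics.QuantumFieldTheory.Balaban1983to89.B6Prop26Gluing (mulOp mulOp_apply ind ind_nonneg)
open Literature.MathematicalPhysics.QuantumFieldTheory.Balaban1983to89.B6UnitTorusCarrier (unitTorusGeo_dist_symm)
open Summit.QuantumFields.YangMills.BalabanUVNodes.N15.CurvedSpecies (uN_val_gaugeTr_eq uN_val_inv_eq_conjTranspose uN_coordMat_conj_orthogonal hasMaj_gaugeConj mmulOp_one)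

variable {d : ℕ}

/-! ## §1 Behind an input cut both far weights are small -/

section Weights

variable {g : B6.Geometry}

/-- `B(S + e^{−δd_Z(z)} + e^{−δd_Z(z′)})e^{−δd(z,z′)} ≤ B(S + 2e^{−δw∕2})e^{−(δ∕2)d(z,z′)}` when `d_Z(z′) ≥ w`, `d_Z ≥ 0` Lipschitz, `d ≥ 0` symmetric. [folklore] -/
theorem farWeights_cut_le (dZ : g.Site → ℝ) {S B δ w : ℝ} (hd : ∀ a b : g.Site, 0 ≤ g.dist a b) (hsymm : ∀ a b : g.Site, g.dist a b = g.dist b a)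
    (hdZ0 : ∀ y, 0 ≤ dZ y) (hdZl : ∀ y z, dZ y ≤ g.dist y z + dZ z) (hS : 0 ≤ S) (hB : 0 ≤ B) (hδ : 0 ≤ δ) (hw : 0 ≤ w) (z z' : g.Site) (hz' : w ≤ dZ z') :
    B * (S + Real.exp (-(δ * dZ z)) + Real.exp (-(δ * dZ z'))) * Real.exp (-(δ * g.dist z z')) ≤
      B * (S + 2 * Real.exp (-(δ / 2 * w))) * Real.exp (-(δ / 2 * g.dist z z')) := by
  have hdist := hd z z'
  have hδd : 0 ≤ δ * g.dist z z' := mul_nonneg hδ hdist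
  have h1 : Real.exp (-(δ * g.dist z z')) ≤ Real.exp (-(δ / 2 * g.dist z z')) := Real.exp_le_exp.mpr (by linarith)
  have hsum : w ≤ g.dist z z' + dZ z := by have h := hdZl z' z; rw [hsymm z' z] at h; linarith
  have h2 : Real.exp (-(δ * dZ z)) * Real.exp (-(δ * g.dist z z')) ≤ Real.exp (-(δ / 2 * w)) * Real.exp (-(δ / 2 * g.dist z z')) := by
    rw [← Real.exp_add, ← Real.exp_add]
    refine Real.exp_le_exp.mpr ?_
    have e1 := mul_le_mul_of_nonneg_left hsum (show (0 : ℝ) ≤ δ / 2 by positivity)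
    have e2 := mul_nonneg hδ (hdZ0 z)
    linarith
  have h3 : Real.exp (-(δ * dZ z')) * Real.exp (-(δ * g.dist z z')) ≤ Real.exp (-(δ / 2 * w)) * Real.exp (-(δ / 2 * g.dist z z')) := by
    rw [← Real.exp_add, ← Real.exp_add]
    refine Real.exp_le_exp.mpr ?_
    have e1 := mul_le_mul_of_nonneg_left hz' hδ
    have e2 := mul_nonneg hδ hw
    linarith
  have hS1 : S * Real.exp (-(δ * g.dist z z')) ≤ S * Real.exp (-(δ / 2 * g.dist z z')) := mul_le_mul_of_nonneg_left h1 hS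
  calc B * (S + Real.exp (-(δ * dZ z)) + Real.exp (-(δ * dZ z'))) * Real.exp (-(δ * g.dist z z'))
      = B * (S * Real.exp (-(δ * g.dist z z')) + Real.exp (-(δ * dZ z)) * Real.exp (-(δ * g.dist z z')) + Real.exp (-(δ * dZ z')) * Real.exp (-(δ * g.dist z z'))) := by ring
    _ ≤ B * (S * Real.exp (-(δ / 2 * g.dist z z')) + Real.exp (-(δ / 2 * w)) * Real.exp (-(δ / 2 * g.dist z z')) + Real.exp (-(δ / 2 * w)) * Real.exp (-(δ / 2 * g.dist z z'))) :=
        mul_le_mul_of_nonneg_left (add_le_add (add_le_add hS1 h2) h3) hB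
    _ = B * (S + 2 * Real.exp (-(δ / 2 * w))) * Real.exp (-(δ / 2 * g.dist z z')) := by ring

end Weights

/-! ## §2 The per-cube Landau letter behind the input cut -/

section Cut

variable {L : ℕ} [NeZero L]

set_option maxHeartbeats 800000 in
/-- ★★★★ **THE PER-CUBE LANDAU LETTER BEHIND THE KNIT's INPUT CUT.**  Under n15-c∕313's hypotheses (`L ≥ 17` odd; unitary `U`; (3.35) letters `ξ, C`; unitary cube gauges `w_k` with
(3.35) potentials for `U^{w_k}` on `c(Lw+6w−m₀,k)+[0,Lw+16w+2)^{d+1}`; letters `r_V`, `Σ₀(r_V) ≤ R₀`, `σ(r_V) ≤ R₀`; `L^m ≥ w₀`): for every cube `k`,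
`(mulVecLin (landauCov (cvT e U^{w_k}) a_K) − mulVecLin (landauCov 𝟙 a_K)) ∘ M_{χ_k} ≤ B·(r_V(1+|J⊕J|) + a_K|ι|(|ι|σ²+2σ) + σ + (L^m)⁻¹ + 2e^{−δL^m})·e^{−δ|z−z′|_T}` on the coloured
bond carrier, `χ_k` the indicator of the blocks of `c(2w,k)+[0,6w+1)^{d+1}` read at the bond (`chiCube`, = n15-c∕181 `cvChi k`).  The `hNVcut` currency of 52's knit for the
(nonlocal) Landau summand; MODEL carriers. [cite: Balaban1985BackgroundPropagators, (3.49) p.399, Thm 3.4 p.400, (3.59)–(3.60) p.402, Cor. 3.8 p.410 (shapes ∕ mechanism); Balaban1984PropagatorsI, (1.20) p.20] -/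
theorem hasMaj_landauCov_gaugeTr_sub_flat_cut (hL : Odd L ∧ 1 < L) (hL17 : 17 ≤ L) {a₀ : ℝ} (ha₀ : 0 < a₀) (ι : Type) [Fintype ι] [DecidableEq ι] :
    ∃ δ w₀ R₀ B : ℝ, 0 < δ ∧ 0 < R₀ ∧ 0 < B ∧
      ∀ (mv kk : ℕ), 1 ≤ kk → w₀ ≤ ((L ^ mv : ℕ) : ℝ) →
      ∀ {mm : Type} [Fintype mm] [DecidableEq mm] [Nonempty mm] (e : Matrix mm mm ℂ ≃L[ℝ] (ι → ℝ)), (∀ A B : Matrix mm mm ℂ, traceForm A B = e A ⬝ᵥ e B) →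
      ∀ (U : Fin (d + 1) → ScX d L mv kk hL → (Matrix mm mm ℂ)ˣ), (∀ μ x, (U μ x : Matrix mm mm ℂ) ∈ Matrix.unitaryGroup mm ℂ) →
      ∀ (ξ C : ℝ), 0 < ξ → 0 < C →
      ∀ (w : (Fin (d + 1) → ZMod (2 * L)) → ScX d L mv kk hL → (Matrix mm mm ℂ)ˣ), (∀ k x, (w k x : Matrix mm mm ℂ) ∈ Matrix.unitaryGroup mm ℂ) →
        (∀ k : Fin (d + 1) → ZMod (2 * L), ∃ A : Fin (d + 1) → ScX d L mv kk hL → Matrix mm mm ℂ,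
          (∀ μ, ∀ z ∈ {x : ScX d L mv kk hL | blockOf (L ^ kk) (cvM d L mv kk hL) x ∈ cubeBlocks (cvM d L mv kk hL) (coverCorner (cvM d L mv kk hL) (L ^ mv) L (L * L ^ mv + 6 * L ^ mv - coverMargin L mv) k) (L * L ^ mv + 16 * L ^ mv + 2)}, gaugeTr (scShift d L mv kk hL) (w k) U μ z = fluct (((((L ^ kk : ℕ) : ℝ))⁻¹)) A μ z) ∧
          (∀ μ, ∀ z ∈ {x : ScX d L mv kk hL | blockOf (L ^ kk) (cvM d L mv kk hL) x ∈ cubeBlocks (cvM d L mv kk hL) (coverCorner (cvM d L mv kk hL) (L ^ mv) L (L * L ^ mv + 6 * L ^ mv - coverMargin L mv) k) (L * L ^ mv + 16 * L ^ mv + 2)}, ‖A μ z‖ < C * ξ⁻¹) ∧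
          (∀ μ ν, ∀ z ∈ {x : ScX d L mv kk hL | blockOf (L ^ kk) (cvM d L mv kk hL) x ∈ cubeBlocks (cvM d L mv kk hL) (coverCorner (cvM d L mv kk hL) (L ^ mv) L (L * L ^ mv + 6 * L ^ mv - coverMargin L mv) k) (L * L ^ mv + 16 * L ^ mv + 2)}, ‖((↑(((((L ^ kk : ℕ) : ℝ))⁻¹)) : ℂ)⁻¹) • covD (scShift d L mv kk hL) (fun _ _ => (1 : (Matrix mm mm ℂ)ˣ)) μ (A ν) z‖ < C * (ξ ^ 2)⁻¹)) →
      ∀ (rV : ℝ), 0 ≤ rV →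
        Fintype.card ι * (@basisConst ι _ (Matrix mm mm ℂ) Matrix.frobeniusNormedAddCommGroup Matrix.frobeniusNormedSpace e * (2 * Real.sqrt (Fintype.card mm)) * (Real.sqrt (Fintype.card mm) * ((C / ξ) * Real.exp (((((L ^ kk : ℕ) : ℝ))⁻¹) * (C / ξ))))) ≤ rV →
        Fintype.card ι * (Fintype.card (Fin (d + 1)) * (Fintype.card ι * (@basisConst ι _ (Matrix mm mm ℂ) Matrix.frobeniusNormedAddCommGroup Matrix.frobeniusNormedSpace e * (2 * Real.sqrt (Fintype.card mm)) * (Real.sqrt (Fintype.card mm) * ((C / ξ) * Real.exp (((((L ^ kk : ℕ) : ℝ))⁻¹) * (C / ξ))))) ^ 2 + @basisConst ι _ (Matrix mm mm ℂ) Matrix.frobeniusNormedAddCommGroup Matrix.frobeniusNormedSpace e * (2 * Real.sqrt (Fintype.card mm)) * (Real.sqrt (Fintype.card mm) * ((C / ξ ^ 2) * Real.exp (((((L ^ kk : ℕ) : ℝ))⁻¹) * (C / ξ)))))) ≤ rV →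
        rV * (1 + Fintype.card (Fin (d + 1) ⊕ Fin (d + 1))) + a₀ * (Fintype.card ι * (Fintype.card ι * ((1 + rV * ((((L ^ kk : ℕ) : ℝ))⁻¹)) ^ ((d + 1) * L ^ kk) - 1) ^ 2 + 2 * ((1 + rV * ((((L ^ kk : ℕ) : ℝ))⁻¹)) ^ ((d + 1) * L ^ kk) - 1))) ≤ R₀ →
        ((1 + rV * ((((L ^ kk : ℕ) : ℝ))⁻¹)) ^ ((d + 1) * L ^ kk) - 1) ≤ R₀ →
      ∀ k : Fin (d + 1) → ZMod (2 * L),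
        HasMaj (BlockNorm.ofBlocks (unitTorusGeo L kk (cvM d L mv kk hL)) (liftBlk (fun b : ScX d L mv kk hL × Fin (d + 1) => blockOf (L ^ kk) (cvM d L mv kk hL) b.1) ι)) (BlockNorm.ofBlocks (unitTorusGeo L kk (cvM d L mv kk hL)) (liftBlk (fun b : ScX d L mv kk hL × Fin (d + 1) => blockOf (L ^ kk) (cvM d L mv kk hL) b.1) ι))
          ((Matrix.mulVecLin (landauCov (cvM d L mv kk hL) (L ^ kk) (cvT e (fun μ x => (gaugeTr (scShift d L mv kk hL) (w k) U μ x : Matrix mm mm ℂ))) (aK a₀ (L : ℝ) kk * (((L ^ kk : ℕ) : ℝ)) ^ (d + 1))) - Matrix.mulVecLin (landauCov (cvM d L mv kk hL) (L ^ kk) (fun (_ : Fin (d + 1)) (_ : ScX d L mv kk hL) => (1 : Matrix ι ι ℝ)) (aK a₀ (L : ℝ) kk * (((L ^ kk : ℕ) : ℝ)) ^ (d + 1)))) ∘ₗ mulOp (fun p : (ScX d L mv kk hL × Fin (d + 1)) × ι => chiCube (cvM d L mv kk hL) (L ^ kk) (coverCorner (cvM d L mv kk hL) (L ^ mv) L (2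 * L ^ mv) k) (6 * L ^ mv + 1) p.1))
          (fun z z' => B * (rV * (1 + Fintype.card (Fin (d + 1) ⊕ Fin (d + 1))) + aK a₀ (L : ℝ) kk * (Fintype.card ι * (Fintype.card ι * ((1 + rV * ((((L ^ kk : ℕ) : ℝ))⁻¹)) ^ ((d + 1) * L ^ kk) - 1) ^ 2 + 2 * ((1 + rV * ((((L ^ kk : ℕ) : ℝ))⁻¹)) ^ ((d + 1) * L ^ kk) - 1))) + ((1 + rV * ((((L ^ kk : ℕ) : ℝ))⁻¹)) ^ ((d + 1) * L ^ kk) - 1) + (((L ^ mv : ℕ) : ℝ))⁻¹ + 2 * Real.exp (-(δ * ((L ^ mv : ℕ) : ℝ)))) * Real.exp (-(δ * (unitTorusGeo L kk (cvM d L mv kk hL)).dist z z'))) := by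
  classical
  obtain ⟨δ₀, w₀, R₀, B₀, hδ₀, hR₀, hB₀, H⟩ := exists_landauCov_gaugeTr_sub_flat_cutBox (d := d) hL hL17 ha₀ ι
  refine ⟨δ₀ / 2, w₀, R₀, B₀, by positivity, hR₀, hB₀, fun mv kk hk hw => ?_⟩
  intro mm _ _ _ e he U hU ξ C hξ hC w hwU hdat rV hrV hrA hrC hRle hσV k
  obtain ⟨dZ, hdZ0, hdZl, hmarg, hmain⟩ := H mv kk hk hw e he U hU ξ C hξ hC w hwU hdat rV hrV hrA hrC hRle hσV k
  have hL1r : (1 : ℝ) < (L : ℝ) := by exact_mod_cast hL.2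
  have hd : ∀ a b : Tor (cvM d L mv kk hL), 0 ≤ (unitTorusGeo L kk (cvM d L mv kk hL)).dist a b := unitTorusGeo_dist_nonneg L kk _
  have hsymm : ∀ a b : Tor (cvM d L mv kk hL), (unitTorusGeo L kk (cvM d L mv kk hL)).dist a b = (unitTorusGeo L kk (cvM d L mv kk hL)).dist b a := unitTorusGeo_dist_symm L kk _
  have hSIG0 : 0 ≤ ((1 + rV * ((((L ^ kk : ℕ) : ℝ))⁻¹)) ^ ((d + 1) * L ^ kk) - 1) := by
    have := one_le_pow₀ (M₀ := ℝ) (a := 1 + rV * ((((L ^ kk : ℕ) : ℝ))⁻¹)) (le_add_of_nonneg_right (by positivity)) (n := (d + 1) * L ^ kk); linarith only [this]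
  have hSum0 : 0 ≤ rV * (1 + Fintype.card (Fin (d + 1) ⊕ Fin (d + 1))) + aK a₀ (L : ℝ) kk * (Fintype.card ι * (Fintype.card ι * ((1 + rV * ((((L ^ kk : ℕ) : ℝ))⁻¹)) ^ ((d + 1) * L ^ kk) - 1) ^ 2 + 2 * ((1 + rV * ((((L ^ kk : ℕ) : ℝ))⁻¹)) ^ ((d + 1) * L ^ kk) - 1))) + ((1 + rV * ((((L ^ kk : ℕ) : ℝ))⁻¹)) ^ ((d + 1) * L ^ kk) - 1) + (((L ^ mv : ℕ) : ℝ))⁻¹ := by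
    have haK := aK_pos ha₀ hL1r hk
    exact add_nonneg (add_nonneg (add_nonneg (mul_nonneg hrV (by positivity)) (mul_nonneg haK.le (mul_nonneg (Nat.cast_nonneg _) (add_nonneg (by positivity) (mul_nonneg zero_le_two hSIG0))))) hSIG0) (by positivity)
  have hK : ∀ z z' : Tor (cvM d L mv kk hL), 0 ≤ B₀ * (rV * (1 + Fintype.card (Fin (d + 1) ⊕ Fin (d + 1))) + aK a₀ (L : ℝ) kk * (Fintype.card ι * (Fintype.card ι * ((1 + rV * ((((L ^ kk : ℕ) : ℝ))⁻¹)) ^ ((d + 1) * L ^ kk) - 1) ^ 2 + 2 * ((1 + rV * ((((L ^ kk : ℕ) : ℝ))⁻¹)) ^ ((d + 1) * L ^ kk) - 1))) + ((1 + rV * ((((L ^ kk : ℕ) : ℝ))⁻¹)) ^ ((d + 1) * L ^ kk) - 1) + (((L ^ mv : ℕ) : ℝ))⁻¹ + Real.exp (-(δ₀ * dZ z)) + Real.exp (-(δ₀ * dZ z'))) * Real.exp (-(δ₀ * (unitTorusGeo L kk (cvM d L mv kk hL)).dist z z')) :=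
    fun z z' => mul_nonneg (mul_nonneg hB₀.le (add_nonneg (add_nonneg hSum0 (Real.exp_nonneg _)) (Real.exp_nonneg _))) (Real.exp_nonneg _)
  have hcut := hasMaj_comp_mulOp_cut (b₂ := BlockNorm.ofBlocks (unitTorusGeo L kk (cvM d L mv kk hL)) (liftBlk (fun b : ScX d L mv kk hL × Fin (d + 1) => blockOf (L ^ kk) (cvM d L mv kk hL) b.1) ι)) (liftBlk (fun b : ScX d L mv kk hL × Fin (d + 1) => blockOf (L ^ kk) (cvM d L mv kk hL) b.1) ι) hK (χ := (fun p : (ScX d L mv kk hL × Fin (d + 1)) × ι => chiCube (cvM d L mv kk hL) (L ^ kk) (coverCorner (cvM d L mv kk hL) (L ^ mv) L (2 * L ^ mv) k) (6 * L ^ mv + 1) p.1)) (S := {y : Tor (cvM d L mv kk hL) | ((L ^ mv : ℕ) : ℝ) ≤ dZ y})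
    (fun p => abs_chiCube_le_one _ _) (fun p hp => by
      have hmem : blockOf (L ^ kk) (cvM d L mv kk hL) p.1.1 ∈ cubeBlocks (cvM d L mv kk hL) (coverCorner (cvM d L mv kk hL) (L ^ mv) L (2 * L ^ mv) k) (6 * L ^ mv + 1) := by
        by_contra hmem
        exact hp (by simp [chiCube, hmem])
      exact hmarg _ hmem) hmain
  refine hcut.mono fun z z' => ?_
  by_cases hz' : ((L ^ mv : ℕ) : ℝ) ≤ dZ z'
  · have hi : ind {y : Tor (cvM d L mv kk hL) | ((L ^ mv : ℕ) : ℝ) ≤ dZ y} z' = 1 := if_pos (show z' ∈ {y : Tor (cvM d L mv kk hL) | ((L ^ mv : ℕ) : ℝ) ≤ dZ y} from hz')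
    rw [hi, one_mul]
    exact farWeights_cut_le dZ hd hsymm hdZ0 hdZl hSum0 hB₀.le hδ₀.le (Nat.cast_nonneg _) z z' hz'
  · have hi : ind {y : Tor (cvM d L mv kk hL) | ((L ^ mv : ℕ) : ℝ) ≤ dZ y} z' = 0 := if_neg (show z' ∉ {y : Tor (cvM d L mv kk hL) | ((L ^ mv : ℕ) : ℝ) ≤ dZ y} from hz')
    rw [hi, zero_mul]
    exact mul_nonneg (mul_nonneg hB₀.le (add_nonneg hSum0 (by positivity))) (Real.exp_nonneg _)

end Cut

end Summit.QuantumFields.YangMills.BalabanUVNodes.N15.Gluing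

end
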